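import Summits.AtomisticToContinuum.HydrodynamicLimit.Theorems.MourreKoopmanChargesOneBodyCompletenessIdentificationInputs
import Summits.AtomisticToContinuum.HydrodynamicLimit.Theorems.MourreKoopmanChargesOneBodyCompletenessIdentificationDecomposition
import HarnessLib

/-!
# `OneBodyCompleteness` (crux stmt-AtomisticToContinuum-9583, route `MourreKoopmanCharges`), line `registered`:
# the identification stub `stub_torusIdentificationUnit` REDUCED to two named inputs (I1), (I2)

Helper file (`--supports stmt-AtomisticToContinuum-9583`) for the registered OPEN CORE #2 `stub_torusIdentificationUnit`
of `Cruxes/OneBodyCompleteness/Lines/birth.lean`.  Main theorem `torusIdentificationUnit_of : (I1) → (I2) → <the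
registered signature>`, constant `K = σ⁻³` (as in the landed statics `torusIdentificationUnit_static`), where, in
terms of the blown-up two-time cell pair functional of the canonical torus gas (`blowUp` by `ε_N⁻¹` around `x ∈ 𝕋³`,
cell `C + ξ` at torus time `s(N+1)^{-1/3}` against cell `C` at time `0`, one-body cell statistics of the profile `h`):
(I1) = its two-time LOCAL LIMIT towards `E_{F.μ}[(A_{h_θ} ∘ τ_{-ξ} ∘ F.flow((√θ/σ)s)) A_{h_θ}]` (the dynamical version of
`Georgii1995_hardSphereCanonicalLocalLimit`: locality in probability of the hard-sphere dynamics uniformly in `N`,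
equivalence of ensembles, low-density DLR uniqueness, Alexander's uniqueness), and (I2) = its UNIFORM-IN-`N` CLUSTERING
for `h ⊥ 1` with measurable weights `|w|, |w'| ≤ 1` (one integrable envelope `c(ξ)`).  Neither has a proof in print
(named `@[conjecture]`s `TwoTimeLocalLimitUnit`, `UniformTorusTwoTimeClustering` in `…IdentificationConjectures.lean`);
everything else is proved: (1) cov = raw moment (`stub_torusMoments`); (2) the EXACT DECOMPOSITION of
`(N+1)·E_{G_N}[A(Φ_τ z) A(z)]` into `σ⁻³ ∫_{𝕋³ × ℝ³} T_N(x, ξ)` (`decomposition_twoTimeMoment`, `3 ε_N < 1/2`); (3) DOMINATED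
CONVERGENCE on `𝕋³ × ℝ³`: on the hard-sphere domain `T_N(x, ξ)` is `‖χ‖² ×` the functional of (I2) with the slowly varying
weights `χ(x + proj(ε(· + ξ)))/‖χ‖` (`cellSum_eq_mul_linStat_blowUp`), whence `|T_N| ≤ ‖χ‖² c(ξ)`; pointwise
`T_N - χ(x)² T⁰_N → 0` by (I2) on the DIFFERENCE weights `(χ(x + proj(ε(· + ξ))) - χ(x))/δ` (`≤ 1` on the cell once
`ε_N (3 + ‖ξ‖)` is below the uniform-continuity modulus of `χ`), and `T⁰_N → C_∞(ξ)` by (I1); (4) the limit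
`σ⁻³ ∫∫ χ(x)² C_∞(ξ) = (∫χ²)·σ⁻³·⟪U_{(√θ/σ)s}[A_{h_θ}], [A_{h_θ}]⟫` (`limit_eq_inner_koopman`).

References: H. Spohn, *Large Scale Dynamics of Interacting Particles* (1991), Part I §7.1 (7.14)–(7.15); S. Olla,
S. R. S. Varadhan, H.-T. Yau, Comm. Math. Phys. 155 (1993) §4; H.-O. Georgii, Probab. Theory Relat. Fields 99 (1995).
-/
noncomputable section

namespace Summit.AtomisticToContinuum.HydrodynamicLimit.Theorems.MourreKoopmanChargesOneBodyCompleteness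

open MeasureTheory ProbabilityTheory Filter Topology Set Function
open scoped ENNReal InnerProductSpace BigOperators
open Literature.Analysis.FluidPDE Literature.MathematicalPhysics.KineticTheory
open Literature.Analysis.FunctionSpaces (PointConfig)
open Literature.Analysis.FunctionSpaces.Torus (proj continuous_proj)
open Literature.Analysis.FluidPDE.Torus (reprSym)
open Summit.AtomisticToContinuum.HydrodynamicLimit.Theorems.MourreKoopmanChargesIdealGasNoDecay
  (exists_bound_of_continuous)

section Reduction

variable {σ θ : ℝ} {N : ℕ}

set_option maxHeartbeats 1600000 in
/-- **REDUCTION OF THE IDENTIFICATION STUB TO ITS TWO NAMED INPUTS** (I1) (two-time local limit, hypothesis `h1`)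
and (I2) (uniform torus two-time clustering, hypothesis `h2`), with the constant `K = σ⁻³` of the landed statics: for every admissible `F`, `h`,
flow family, `χ` and `s`, `(N+1)·cov_{G_N}(A_h(χ)∘Φ_{s(N+1)^{-1/3}}, A_h(χ)) → (∫χ²)·σ⁻³·⟪U_{(√θ/σ)s}[A_{h_θ}], [A_{h_θ}]⟫`.
Proof: cov = raw moment (`stub_torusMoments`); exact decomposition into blown-up two-time cell pair functionals
(`decomposition_twoTimeMoment`); dominated convergence on `𝕋³ × ℝ³` with the envelope of (I2) applied to the slowly
varying weights `χ(x + proj(ε(· + ξ)))/‖χ‖`, the pointwise limit being `χ(x)²` times the limit of (I1) (the weight is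
removed by (I2) again, through the uniform continuity of `χ` on the compact torus); the limit is identified by
`limit_eq_inner_koopman`. [Spohn1991 Part I §7.1 (7.14)–(7.15)] -/
theorem torusIdentificationUnit_of
    (h1 : ∃ z₂ : ℝ, 0 < z₂ ∧ ∀ σ : ℝ, 0 < σ → σ < 1 / 2 → ∀ z : ℝ, 0 < z → z < z₂ → ∀ θ : ℝ, 0 < θ →
      ∀ F : HardSphereFluctuationData 1, IsHardSphereGibbs 1 z 1 (0 : V3) F.μ →
      (∃ Φ : InfiniteHardSphereFlow (Fin 3) 1, Φ.IsEquilibriumFlow ∧ ∀ t : ℝ, F.flow t =ᵐ[F.μ] Φ.flow t) →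
      (∫ ω, cellCharge 0 ω ∂F.μ = σ ^ 3) →
      ∀ h : V3 → ℝ, Continuous h → (∃ (C : ℝ) (k : ℕ), ∀ v, |h v| ≤ C * (1 + ‖v‖) ^ k) →
      (∫ v, h v * localMaxwellian 1 θ (0 : V3) v = 0) →
      ∀ (Φ : (N : ℕ) → HardSphereFlow (Torus.geometry (Fin 3)) (hsDiameter σ N) (N + 1)) (s : ℝ) (x : T3)
      (ξ : V3),
      Tendsto (fun N : ℕ => ∫ z, cellObs h (spatialShift (-ξ) (blowUp (hsDiameter σ N) x
      ((Φ N).flow (s * ((N : ℝ) + 1) ^ (-(1 / 3 : ℝ))) z))) * cellObs h (blowUp (hsDiameter σ N) x z)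
      ∂(localGibbsLaw σ (fun _ => 1) (fun _ => 0) (fun _ => θ) N (Φ N))) atTop
      (𝓝 (∫ ω, cellObs (fun w => h (Real.sqrt θ • w)) (spatialShift (-ξ) (F.flow (Real.sqrt θ / σ * s) ω)) *
      cellObs (fun w => h (Real.sqrt θ • w)) ω ∂F.μ)))
    (h2 : ∀ σ : ℝ, 0 < σ → σ < 1 / 2 → ∀ θ : ℝ, 0 < θ →
      ∀ h : V3 → ℝ, Continuous h → (∃ (C : ℝ) (k : ℕ), ∀ v, |h v| ≤ C * (1 + ‖v‖) ^ k) →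
      (∫ v, h v * localMaxwellian 1 θ (0 : V3) v = 0) →
      ∀ (Φ : (N : ℕ) → HardSphereFlow (Torus.geometry (Fin 3)) (hsDiameter σ N) (N + 1)) (s : ℝ),
      ∃ c : V3 → ℝ, Integrable c ∧ ∃ N₀ : ℕ, ∀ N : ℕ, N₀ ≤ N → ∀ (x : T3) (ξ : V3) (w w' : V3 → ℝ),
      Measurable w → Measurable w' → (∀ q, |w q| ≤ 1) → (∀ q, |w' q| ≤ 1) →
      |∫ z, linStat (fun p => (unitCell : Set V3).indicator w (p.1 - ξ) * h p.2) (blowUp (hsDiameter σ N) x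
      ((Φ N).flow (s * ((N : ℝ) + 1) ^ (-(1 / 3 : ℝ))) z)) *
      linStat (fun p => (unitCell : Set V3).indicator w' p.1 * h p.2) (blowUp (hsDiameter σ N) x z)
      ∂(localGibbsLaw σ (fun _ => 1) (fun _ => 0) (fun _ => θ) N (Φ N))| ≤ c ξ) :
    ∃ z₂ : ℝ, 0 < z₂ ∧ ∀ σ : ℝ, 0 < σ → σ < 1 / 2 → ∀ z : ℝ, 0 < z → z < z₂ → ∀ θ : ℝ, 0 < θ →
      ∀ F : Literature.MathematicalPhysics.KineticTheory.HardSphereFluctuationData 1,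
        Literature.Analysis.FluidPDE.IsHardSphereGibbs 1 z 1
          (0 : Literature.MathematicalPhysics.KineticTheory.V3) F.μ →
        (∃ Φ : Literature.Analysis.FluidPDE.InfiniteHardSphereFlow (Fin 3) 1,
          Φ.IsEquilibriumFlow ∧ ∀ t : ℝ, F.flow t =ᵐ[F.μ] Φ.flow t) →
        (∫ ω, Literature.MathematicalPhysics.KineticTheory.cellCharge 0 ω ∂F.μ = σ ^ 3) →
        ∀ h : Literature.MathematicalPhysics.KineticTheory.V3 → ℝ, Continuous h →
          (∃ (C : ℝ) (k : ℕ), ∀ v, |h v| ≤ C * (1 + ‖v‖) ^ k) →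
          Literature.MathematicalPhysics.KineticTheory.cellObs (fun w => h (Real.sqrt θ • w)) ∈ F.localObs →
          (∫ v, h v * Literature.Analysis.FluidPDE.localMaxwellian 1 θ
              (0 : Literature.MathematicalPhysics.KineticTheory.V3) v = 0) →
          (∀ i : Fin 3, ∫ v, h v * v i * Literature.Analysis.FluidPDE.localMaxwellian 1 θ
              (0 : Literature.MathematicalPhysics.KineticTheory.V3) v = 0) →
          (∫ v, h v * ‖v‖ ^ 2 * Literature.Analysis.FluidPDE.localMaxwellian 1 θ
              (0 : Literature.MathematicalPhysics.KineticTheory.V3) v = 0) →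
          ∃ K : ℝ, ∀ Φ : (N : ℕ) → Literature.Analysis.FluidPDE.HardSphereFlow
              (Literature.Analysis.FluidPDE.Torus.geometry (Fin 3))
              (Literature.MathematicalPhysics.KineticTheory.hsDiameter σ N) (N + 1),
          ∀ χ : Literature.MathematicalPhysics.KineticTheory.T3 → ℝ, Continuous χ → ∀ s : ℝ,
            Tendsto (fun N : ℕ => ((N : ℝ) + 1) *
                cov[fun z => ∫ y, χ y.1 * h y.2 ∂(Literature.Analysis.FluidPDE.empiricalMeasure
                      ((Φ N).flow (s * ((N : ℝ) + 1) ^ (-(1 / 3 : ℝ))) z)),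
                    fun z => ∫ y, χ y.1 * h y.2 ∂(Literature.Analysis.FluidPDE.empiricalMeasure z);
                  Literature.MathematicalPhysics.KineticTheory.localGibbsLaw σ (fun _ => 1)
                    (fun _ => 0) (fun _ => θ) N (Φ N)])
              atTop (𝓝 ((∫ x, χ x * χ x) * K *
                ⟪F.koopman (Real.sqrt θ / σ * s)
                    (F.fluct (Literature.MathematicalPhysics.KineticTheory.cellObs
                      (fun w => h (Real.sqrt θ • w)))),
                  F.fluct (Literature.MathematicalPhysics.KineticTheory.cellObs
                    (fun w => h (Real.sqrt θ • w)))⟫_ℝ)) := by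
  obtain ⟨z₂, hz₂, H1⟩ := h1
  refine ⟨z₂, hz₂, ?_⟩
  intro σ hσ hσhalf z hz hzlt θ hθ F hG hflow hdens h hh hb hmem hm0 _hm1 _hm2
  refine ⟨(σ ^ 3)⁻¹, ?_⟩
  intro Φ χ hχ s
  have hσ2 : σ ≤ 1 / 2 := hσhalf.le
  -- the label form of the weighted cell statistics in the blown-up frame (a local function)
  let cs : ∀ {n : ℕ}, ℝ → (T3 → ℝ) → (V3 → ℝ) → T3 → V3 → Config n (Fin 3) T3 → ℝ :=
    @fun n ε χ' h' x ξ w => ∑ j, (unitCell : Set V3).indicator (fun _ => (1 : ℝ)) (ε⁻¹ • reprSym ((w j).1 - x) - ξ) *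
      (χ' (w j).1 * h' (w j).2)
  have hcs : ∀ {n : ℕ} (ε : ℝ) (χ' : T3 → ℝ) (h' : V3 → ℝ) (x : T3) (ξ : V3) (w : Config n (Fin 3) T3),
      cs ε χ' h' x ξ w = ∑ j, (unitCell : Set V3).indicator (fun _ => (1 : ℝ)) (ε⁻¹ • reprSym ((w j).1 - x) - ξ) *
        (χ' (w j).1 * h' (w j).2) := fun _ _ _ _ _ _ => rfl
  obtain ⟨B₀, hB₀0, hB₀⟩ := exists_bound_of_continuous hχ
  -- a positive bound `B ≥ 1` for `|χ|`
  set B : ℝ := max B₀ 1 with hBdef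
  have hB0 : 0 < B := lt_of_lt_of_le one_pos (le_max_right _ _)
  have hBχ : ∀ y, |χ y| ≤ B := fun y => (hB₀ y).trans (le_max_left _ _)
  -- the envelope of (I2) and the threshold
  obtain ⟨c, hc, N₀, H2⟩ := h2 σ hσ hσhalf θ hθ h hh hb hm0 Φ s
  -- notation
  set T : ℕ → T3 × V3 → ℝ := fun N p => ∫ z, cs (hsDiameter σ N) χ h p.1 p.2 
      ((Φ N).flow (s * ((N : ℝ) + 1) ^ (-(1 / 3 : ℝ))) z) * cs (hsDiameter σ N) χ h p.1 0 z
      ∂(localGibbsLaw σ (fun _ => 1) (fun _ => 0) (fun _ => θ) N (Φ N)) with hTdef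
  set T₀ : ℕ → T3 × V3 → ℝ := fun N p => ∫ z, cs (hsDiameter σ N) (fun _ => (1 : ℝ)) h p.1 p.2 
      ((Φ N).flow (s * ((N : ℝ) + 1) ^ (-(1 / 3 : ℝ))) z) * cs (hsDiameter σ N) (fun _ => (1 : ℝ)) h p.1 0 z
      ∂(localGibbsLaw σ (fun _ => 1) (fun _ => 0) (fun _ => θ) N (Φ N)) with hT₀def
  set Cinf : V3 → ℝ := fun ξ => ∫ ω, cellObs (fun w => h (Real.sqrt θ • w))
      (spatialShift (-ξ) (F.flow (Real.sqrt θ / σ * s) ω)) * cellObs (fun w => h (Real.sqrt θ • w)) ω ∂F.μ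
    with hCinfdef
  have hε : ∀ N, 0 < hsDiameter σ N := fun N => hsDiameter_pos hσ N
  have hεne : ∀ N, hsDiameter σ N ≠ 0 := fun N => (hε N).ne'
  haveI hprob : ∀ N, IsProbabilityMeasure (localGibbsLaw σ (fun _ => 1) (fun _ => 0) (fun _ => θ) N (Φ N)) :=
    fun N => isProbabilityMeasure_localGibbsLaw_const hθ hσ2 (0 : V3) N (Φ N)
  -- a.e. the configuration and its image are good (distinct positions)
  have hgood : ∀ (N : ℕ) (t : ℝ), ∀ᵐ z ∂(localGibbsLaw σ (fun _ => 1) (fun _ => 0) (fun _ => θ) N (Φ N)),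
      Injective (fun j => (z j).1) ∧ Injective (fun j => (((Φ N).flow t z) j).1) := by
    intro N t
    filter_upwards [ae_mem_good_localGibbsLaw σ (fun _ => 1) (fun _ => 0) (fun _ => θ) N (Φ N)] with z hz
    exact ⟨pos_injective_of_mem_hardSphereDomain (hε N) ((Φ N).good_subset hz),
      pos_injective_of_mem_hardSphereDomain (hε N) ((Φ N).good_subset ((Φ N).mapsTo_good t hz))⟩
  -- STEP 1: eventually, `(N+1) cov = σ⁻³ ∫ T_N`
  have hev3 : ∀ᶠ N : ℕ in atTop, hsDiameter σ N * 3 < 1 / 2 := by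
    have ht := (tendsto_hsDiameter σ).mul_const (3 : ℝ)
    rw [zero_mul] at ht
    exact ht.eventually (gt_mem_nhds (by norm_num))
  have hS1 : ∀ᶠ N : ℕ in atTop, ((N : ℝ) + 1) *
      cov[fun z => ∫ y, χ y.1 * h y.2 ∂(empiricalMeasure ((Φ N).flow (s * ((N : ℝ) + 1) ^ (-(1 / 3 : ℝ))) z)),
          fun z => ∫ y, χ y.1 * h y.2 ∂(empiricalMeasure z);
        localGibbsLaw σ (fun _ => 1) (fun _ => 0) (fun _ => θ) N (Φ N)] =
      (σ ^ 3)⁻¹ * ∫ p : T3 × V3, T N p ∂((volume : Measure T3).prod (volume : Measure V3)) := by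
    filter_upwards [hev3] with N hN
    rw [(stub_torusMoments σ hσ hσhalf θ hθ h hh hb hm0 N (Φ N) χ hχ _).1,
      decomposition_twoTimeMoment cs hcs hσ hσ2 hθ hN (Φ N) hχ hh hb]
  -- STEP 2: the integrands `T_N` are a.e. strongly measurable
  have hTmeas : ∀ N, AEStronglyMeasurable (T N) ((volume : Measure T3).prod (volume : Measure V3)) := fun N =>
    (integrable_cellSum_pair cs hcs hθ hσ2 (Φ N) hχ hh hb (hsDiameter σ N) _).integral_prod_left.aestronglyMeasurable
  -- STEP 3: domination `|T_N (x, ξ)| ≤ B² c(ξ)` for `N ≥ N₀` (I2 with the slowly varying weights)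
  have hwmeas : ∀ (N : ℕ) (x : T3) (ξ : V3) (W : T3 → ℝ), Continuous W → ∀ D : ℝ,
      Measurable fun y : V3 => W (x + proj (hsDiameter σ N • (y + ξ))) / D := by
    intro N x ξ W hWc D
    have c0 : Continuous fun y : V3 => y + ξ := continuous_id.add continuous_const
    have c1 : Continuous fun y : V3 => hsDiameter σ N • (y + ξ) := (continuous_const_smul (hsDiameter σ N)).comp c0
    have c2 : Continuous fun y : V3 => x + proj (hsDiameter σ N • (y + ξ)) := continuous_const.add (continuous_proj.comp c1)
    have c3 : Continuous fun y : V3 => W (x + proj (hsDiameter σ N • (y + ξ))) := hWc.comp c2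
    exact c3.measurable.div_const D
  have hwmeas0 : ∀ (N : ℕ) (x : T3) (W : T3 → ℝ), Continuous W → ∀ D : ℝ,
      Measurable fun y : V3 => W (x + proj (hsDiameter σ N • y)) / D := by
    intro N x W hWc D
    have c1 : Continuous fun y : V3 => hsDiameter σ N • y := continuous_const_smul (hsDiameter σ N)
    have c2 : Continuous fun y : V3 => x + proj (hsDiameter σ N • y) := continuous_const.add (continuous_proj.comp c1)
    have c3 : Continuous fun y : V3 => W (x + proj (hsDiameter σ N • y)) := hWc.comp c2
    exact c3.measurable.div_const D
  have hTform : ∀ (N : ℕ) (x : T3) (ξ : V3), T N (x, ξ) = B ^ 2 *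
      ∫ z, linStat (fun p => (unitCell : Set V3).indicator (fun y => χ (x + proj (hsDiameter σ N • (y + ξ))) / B)
          (p.1 - ξ) * h p.2) (blowUp (hsDiameter σ N) x ((Φ N).flow (s * ((N : ℝ) + 1) ^ (-(1 / 3 : ℝ))) z)) *
        linStat (fun p => (unitCell : Set V3).indicator (fun y => χ (x + proj (hsDiameter σ N • y)) / B) p.1 * h p.2)
          (blowUp (hsDiameter σ N) x z) ∂(localGibbsLaw σ (fun _ => 1) (fun _ => 0) (fun _ => θ) N (Φ N)) := by
    intro N x ξ
    simp only [hTdef]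
    rw [← integral_const_mul]
    refine integral_congr_ae ?_
    filter_upwards [hgood N (s * ((N : ℝ) + 1) ^ (-(1 / 3 : ℝ)))] with z hz
    rw [cellSum_eq_mul_linStat_blowUp cs hcs (hεne N) χ hB0.ne' h x ξ hz.2,
      cellSum_zero_eq_mul_linStat_blowUp cs hcs (hεne N) χ hB0.ne' h x hz.1]
    ring
  have hwle : ∀ (N : ℕ) (x : T3) (ξ : V3) (y : V3), |χ (x + proj (hsDiameter σ N • (y + ξ))) / B| ≤ 1 :=
    fun N x ξ y => by rw [abs_div, abs_of_pos hB0, div_le_one hB0]; exact hBχ _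
  have hwle0 : ∀ (N : ℕ) (x : T3) (y : V3), |χ (x + proj (hsDiameter σ N • y)) / B| ≤ 1 :=
    fun N x y => by rw [abs_div, abs_of_pos hB0, div_le_one hB0]; exact hBχ _
  have hS3 : ∀ᶠ N : ℕ in atTop, ∀ᵐ p ∂((volume : Measure T3).prod (volume : Measure V3)), ‖T N p‖ ≤ B ^ 2 * c p.2 := by
    filter_upwards [eventually_ge_atTop N₀] with N hN
    refine ae_of_all _ fun p => ?_
    obtain ⟨x, ξ⟩ := p
    rw [Real.norm_eq_abs, hTform N x ξ, abs_mul, abs_of_nonneg (sq_nonneg B)]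
    exact mul_le_mul_of_nonneg_left (H2 N hN x ξ _ _ (hwmeas N x ξ χ hχ B) (hwmeas0 N x χ hχ B) (hwle N x ξ)
      (hwle0 N x)) (sq_nonneg B)
  -- STEP 4: the envelope is integrable on `𝕋³ × ℝ³`
  have hS4 : Integrable (fun p : T3 × V3 => B ^ 2 * c p.2) ((volume : Measure T3).prod (volume : Measure V3)) :=
    (integrable_const (B ^ 2)).mul_prod hc
  -- STEP 5: pointwise convergence `T_N (x, ξ) → χ(x)² C∞(ξ)`
  have hS5 : ∀ p : T3 × V3, Tendsto (fun N => T N p) atTop (𝓝 ((fun y : T3 => χ y * χ y) p.1 * Cinf p.2)) := by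
    rintro ⟨x, ξ⟩
    show Tendsto (fun N => T N (x, ξ)) atTop (𝓝 (χ x * χ x * Cinf ξ))
    -- (a) the unweighted functional converges by (I1)
    have ha : Tendsto (fun N => T₀ N (x, ξ)) atTop (𝓝 (Cinf ξ)) := by
      refine (H1 σ hσ hσhalf z hz hzlt θ hθ F hG hflow hdens h hh hb hm0 Φ s x ξ).congr fun N => ?_
      simp only [hT₀def]
      refine integral_congr_ae ?_
      filter_upwards [hgood N (s * ((N : ℝ) + 1) ^ (-(1 / 3 : ℝ)))] with w hw
      rw [cellObs_spatialShift_neg, linStat_indicator_blowUp_eq_cellSum cs hcs (hεne N) h x ξ hw.2,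
        cellObs_eq_linStat_indicator, linStat_indicator_blowUp_eq_cellSum_zero cs hcs (hεne N) h x hw.1]
    -- (b) the weight is removed by (I2): `T_N - χ(x)² T₀_N → 0`
    have hb' : Tendsto (fun N => T N (x, ξ) - χ x * χ x * T₀ N (x, ξ)) atTop (𝓝 0) := by
      rw [Metric.tendsto_atTop]
      intro e he
      -- uniform continuity of `χ` at precision `δ`
      set δ : ℝ := e / (4 * B * (|c ξ| + 1)) with hδdef
      have hden : 0 < 4 * B * (|c ξ| + 1) := by positivity
      have hδ : 0 < δ := div_pos he hden
      obtain ⟨ρ, hρ, hUC⟩ := Metric.uniformContinuous_iff.1 (CompactSpace.uniformContinuous_of_continuous hχ) δ hδ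
      -- the scale is eventually small
      have hevρ : ∀ᶠ N : ℕ in atTop, hsDiameter σ N * (3 + ‖ξ‖) < ρ := by
        have ht := (tendsto_hsDiameter σ).mul_const (3 + ‖ξ‖)
        rw [zero_mul] at ht
        exact ht.eventually (gt_mem_nhds hρ)
      obtain ⟨N₁, hN₁⟩ := eventually_atTop.1 (hevρ.and (eventually_ge_atTop N₀))
      refine ⟨N₁, fun N hN => ?_⟩
      obtain ⟨hNρ, hNN₀⟩ := hN₁ N hN
      rw [dist_zero_right, Real.norm_eq_abs]
      -- the modulus on the two cells
      have hmod : ∀ (η : V3) (y : V3), ‖η‖ ≤ ‖ξ‖ → y ∈ (unitCell : Set V3) →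
          |χ (x + proj (hsDiameter σ N • (y + η))) - χ x| ≤ δ := by
        intro η y hη hy
        have hd : dist (x + proj (hsDiameter σ N • (y + η))) x < ρ := by
          rw [dist_eq_norm, add_sub_cancel_left]
          calc ‖proj (hsDiameter σ N • (y + η))‖ ≤ ‖hsDiameter σ N • (y + η)‖ := KiferCompactification.norm_proj_le _
            _ = hsDiameter σ N * ‖y + η‖ := by rw [norm_smul, Real.norm_eq_abs, abs_of_pos (hε N)]
            _ ≤ hsDiameter σ N * (3 + ‖ξ‖) := by
                refine mul_le_mul_of_nonneg_left ?_ (hε N).le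
                exact (norm_add_le _ _).trans (add_le_add (norm_le_of_mem_unitCell hy) hη)
            _ < ρ := hNρ
        have := hUC hd
        rw [Real.dist_eq] at this
        exact this.le
      -- the two clamped difference weights
      set wξ : V3 → ℝ := (unitCell : Set V3).indicator fun y => (χ (x + proj (hsDiameter σ N • (y + ξ))) - χ x) / δ
        with hwξ
      set w0 : V3 → ℝ := (unitCell : Set V3).indicator fun y => (χ (x + proj (hsDiameter σ N • y)) - χ x) / δ with hw0
      have hwξm : Measurable wξ := (hwmeas N x ξ (fun y => χ y - χ x) (hχ.sub continuous_const) δ).indicator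
        measurableSet_unitCell
      have hw0m : Measurable w0 := (hwmeas0 N x (fun y => χ y - χ x) (hχ.sub continuous_const) δ).indicator
        measurableSet_unitCell
      have hwξle : ∀ y, |wξ y| ≤ 1 := by
        intro y
        simp only [hwξ]
        by_cases hy : y ∈ (unitCell : Set V3)
        · rw [Set.indicator_of_mem hy, abs_div, abs_of_pos hδ, div_le_one hδ]
          exact hmod ξ y le_rfl hy
        · rw [Set.indicator_of_notMem hy, abs_zero]; exact zero_le_one
      have hw0le : ∀ y, |w0 y| ≤ 1 := by
        intro y
        simp only [hw0]
        by_cases hy : y ∈ (unitCell : Set V3)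
        · rw [Set.indicator_of_mem hy, abs_div, abs_of_pos hδ, div_le_one hδ]
          have := hmod 0 y (by simp) hy
          simpa only [add_zero] using this
        · rw [Set.indicator_of_notMem hy, abs_zero]; exact zero_le_one
      -- the two (I2) bounds
      have hI := H2 N hNN₀ x ξ wξ _ hwξm (hwmeas0 N x χ hχ B) hwξle (hwle0 N x)
      have hII := H2 N hNN₀ x ξ _ w0 (measurable_const : Measurable fun _ : V3 => (1 : ℝ)) hw0m (fun _ => by simp) hw0le
      simp only [hwξ, hw0, Set.indicator_indicator, Set.inter_self] at hI hII
      -- the algebraic split of `T_N - χ(x)² T₀_N`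
      have hsplit : T N (x, ξ) - χ x * χ x * T₀ N (x, ξ) =
          δ * B * ∫ z, linStat (fun p => (unitCell : Set V3).indicator
              (fun y => (χ (x + proj (hsDiameter σ N • (y + ξ))) - χ x) / δ) (p.1 - ξ) * h p.2)
              (blowUp (hsDiameter σ N) x ((Φ N).flow (s * ((N : ℝ) + 1) ^ (-(1 / 3 : ℝ))) z)) *
            linStat (fun p => (unitCell : Set V3).indicator (fun y => χ (x + proj (hsDiameter σ N • y)) / B) p.1 *
              h p.2) (blowUp (hsDiameter σ N) x z) ∂(localGibbsLaw σ (fun _ => 1) (fun _ => 0) (fun _ => θ) N (Φ N)) +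
          χ x * δ * ∫ z, linStat (fun p => (unitCell : Set V3).indicator (fun _ => (1 : ℝ)) (p.1 - ξ) * h p.2)
              (blowUp (hsDiameter σ N) x ((Φ N).flow (s * ((N : ℝ) + 1) ^ (-(1 / 3 : ℝ))) z)) *
            linStat (fun p => (unitCell : Set V3).indicator
              (fun y => (χ (x + proj (hsDiameter σ N • y)) - χ x) / δ) p.1 * h p.2) (blowUp (hsDiameter σ N) x z)
              ∂(localGibbsLaw σ (fun _ => 1) (fun _ => 0) (fun _ => θ) N (Φ N)) := by
        simp only [hTdef, hT₀def]
        -- integrability of the four label-form products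
        have i1 := integrable_cellSum_flow_mul cs hcs hθ hσ2 (Φ N) (hsDiameter σ N) (s * ((N : ℝ) + 1) ^ (-(1 / 3 : ℝ)))
          hχ.measurable hχ.measurable hBχ hBχ hh hb x ξ 0
        have i2 := integrable_cellSum_flow_mul cs hcs hθ hσ2 (Φ N) (hsDiameter σ N) (s * ((N : ℝ) + 1) ^ (-(1 / 3 : ℝ)))
          (measurable_const : Measurable fun _ : T3 => (1 : ℝ)) (measurable_const : Measurable fun _ : T3 => (1 : ℝ))
          (B := 1) (B' := 1) (fun _ => by simp) (fun _ => by simp) hh hb x ξ 0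
        have hdiffB : ∀ y, |χ y - χ x| ≤ 2 * B := fun y => by
          calc |χ y - χ x| ≤ |χ y| + |χ x| := abs_sub _ _
            _ ≤ B + B := add_le_add (hBχ _) (hBχ _)
            _ = 2 * B := by ring
        have hWm : Measurable fun y : T3 => χ y - χ x := hχ.measurable.sub measurable_const
        have i3 := integrable_cellSum_flow_mul cs hcs hθ hσ2 (Φ N) (hsDiameter σ N) (s * ((N : ℝ) + 1) ^ (-(1 / 3 : ℝ)))
          hWm hχ.measurable hdiffB hBχ hh hb x ξ 0
        have i4 := integrable_cellSum_flow_mul cs hcs hθ hσ2 (Φ N) (hsDiameter σ N) (s * ((N : ℝ) + 1) ^ (-(1 / 3 : ℝ)))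
          (measurable_const : Measurable fun _ : T3 => (1 : ℝ)) hWm (B := 1)
          (fun _ => by simp) hdiffB hh hb x ξ 0
        -- the linear-statistic forms of the two weight-removal integrands are integrable (a.e. equal to label forms)
        have j3 : Integrable (fun w => δ * B * (linStat (fun p => (unitCell : Set V3).indicator
              (fun y => (χ (x + proj (hsDiameter σ N • (y + ξ))) - χ x) / δ) (p.1 - ξ) * h p.2)
              (blowUp (hsDiameter σ N) x ((Φ N).flow (s * ((N : ℝ) + 1) ^ (-(1 / 3 : ℝ))) w)) *
            linStat (fun p => (unitCell : Set V3).indicator (fun y => χ (x + proj (hsDiameter σ N • y)) / B) p.1 *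
              h p.2) (blowUp (hsDiameter σ N) x w)))
            (localGibbsLaw σ (fun _ => 1) (fun _ => 0) (fun _ => θ) N (Φ N)) := by
          refine i3.congr ?_
          filter_upwards [hgood N (s * ((N : ℝ) + 1) ^ (-(1 / 3 : ℝ)))] with w hw
          rw [cellSum_eq_mul_linStat_blowUp cs hcs (hεne N) (fun y => χ y - χ x) hδ.ne' h x ξ hw.2,
            cellSum_zero_eq_mul_linStat_blowUp cs hcs (hεne N) χ hB0.ne' h x hw.1]
          beta_reduce
          ring
        have j4 : Integrable (fun w => χ x * δ * (linStat (fun p => (unitCell : Set V3).indicator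
              (fun _ => (1 : ℝ)) (p.1 - ξ) * h p.2)
              (blowUp (hsDiameter σ N) x ((Φ N).flow (s * ((N : ℝ) + 1) ^ (-(1 / 3 : ℝ))) w)) *
            linStat (fun p => (unitCell : Set V3).indicator
              (fun y => (χ (x + proj (hsDiameter σ N • y)) - χ x) / δ) p.1 * h p.2) (blowUp (hsDiameter σ N) x w)))
            (localGibbsLaw σ (fun _ => 1) (fun _ => 0) (fun _ => θ) N (Φ N)) := by
          refine (i4.const_mul (χ x)).congr ?_
          filter_upwards [hgood N (s * ((N : ℝ) + 1) ^ (-(1 / 3 : ℝ)))] with w hw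
          rw [← linStat_indicator_blowUp_eq_cellSum cs hcs (hεne N) h x ξ hw.2,
            cellSum_zero_eq_mul_linStat_blowUp cs hcs (hεne N) (fun y => χ y - χ x) hδ.ne' h x hw.1]
          beta_reduce
          ring
        -- `a b - c² a₁ b₁ = (a - c a₁) b + c (a₁ (b - c b₁))`
        have key : ∀ a b a₁ b₁ cc : ℝ, a * b - cc * cc * (a₁ * b₁) = (a - cc * a₁) * b + cc * (a₁ * (b - cc * b₁)) :=
          fun a b a₁ b₁ cc => by ring
        rw [← integral_const_mul (δ * B), ← integral_const_mul (χ x * δ), ← integral_const_mul (χ x * χ x),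
          ← integral_sub i1 (i2.const_mul _), ← integral_add j3 j4]
        refine integral_congr_ae ?_
        filter_upwards [hgood N (s * ((N : ℝ) + 1) ^ (-(1 / 3 : ℝ)))] with w hw
        rw [key, cellSum_sub_const_mul cs hcs, cellSum_sub_const_mul cs hcs,
          cellSum_eq_mul_linStat_blowUp cs hcs (hεne N) (fun y => χ y - χ x) hδ.ne' h x ξ hw.2,
          cellSum_zero_eq_mul_linStat_blowUp cs hcs (hεne N) χ hB0.ne' h x hw.1,
          ← linStat_indicator_blowUp_eq_cellSum cs hcs (hεne N) h x ξ hw.2,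
          cellSum_zero_eq_mul_linStat_blowUp cs hcs (hεne N) (fun y => χ y - χ x) hδ.ne' h x hw.1]
        beta_reduce
        ring
      -- the final estimate
      obtain ⟨I₁, I₂, hTI, hI₁, hI₂⟩ : ∃ I₁ I₂ : ℝ, T N (x, ξ) - χ x * χ x * T₀ N (x, ξ) = δ * B * I₁ + χ x * δ * I₂ ∧
          |I₁| ≤ c ξ ∧ |I₂| ≤ c ξ := ⟨_, _, hsplit, hI, hII⟩
      rw [hTI]
      have hc0 : 0 ≤ c ξ := (abs_nonneg _).trans hI₁
      calc |δ * B * I₁ + χ x * δ * I₂| ≤ |δ * B * I₁| + |χ x * δ * I₂| := abs_add_le _ _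
        _ = δ * B * |I₁| + |χ x| * δ * |I₂| := by
            rw [abs_mul, abs_mul, abs_mul, abs_mul, abs_of_pos hδ, abs_of_pos hB0]
        _ ≤ δ * B * c ξ + B * δ * c ξ := by
            gcongr
            · exact hBχ x
        _ = 2 * B * c ξ * δ := by ring
        _ ≤ 2 * B * (|c ξ| + 1) * δ := by
            gcongr
            linarith [le_abs_self (c ξ)]
        _ = e / 2 := by
            rw [hδdef]
            field_simp
            ring
        _ < e := half_lt_self he
    -- (c) combine
    have hc' := hb'.add (ha.const_mul (χ x * χ x))
    rw [zero_add] at hc'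
    exact hc'.congr fun N => by ring
  -- STEP 6: dominated convergence on `𝕋³ × ℝ³`
  have hDCT : Tendsto (fun N => ∫ p : T3 × V3, T N p ∂((volume : Measure T3).prod (volume : Measure V3))) atTop
      (𝓝 (∫ p : T3 × V3, (fun y : T3 => χ y * χ y) p.1 * Cinf p.2 ∂((volume : Measure T3).prod (volume : Measure V3)))) :=
    tendsto_integral_filter_of_dominated_convergence (fun p => B ^ 2 * c p.2) (Eventually.of_forall hTmeas) hS3 hS4
      (ae_of_all _ hS5)
  -- STEP 7: the limit
  have hlim := limit_eq_inner_koopman (σ := σ) hz hθ F hG hh hb hmem hm0 χ s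
  have hfinal : Tendsto (fun N => (σ ^ 3)⁻¹ * ∫ p : T3 × V3, T N p ∂((volume : Measure T3).prod (volume : Measure V3)))
      atTop (𝓝 ((∫ x, χ x * χ x) * (σ ^ 3)⁻¹ *
        ⟪F.koopman (Real.sqrt θ / σ * s) (F.fluct (cellObs (fun w => h (Real.sqrt θ • w)))),
          F.fluct (cellObs (fun w => h (Real.sqrt θ • w)))⟫_ℝ)) := by
    rw [← hlim]
    have hc := hDCT.const_mul ((σ ^ 3)⁻¹)
    rw [integral_prod_mul (fun y : T3 => χ y * χ y) Cinf] at hc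
    simpa only [hCinfdef] using hc
  exact hfinal.congr' (EventuallyEq.symm hS1)


end Reduction

end Summit.AtomisticToContinuum.HydrodynamicLimit.Theorems.MourreKoopmanChargesOneBodyCompleteness

end
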